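import Mathlib.MeasureTheory.Integral.Average
import Literature.Analysis.FluidPDE.PartialRegularity
import HarnessLib
import HarnessLib.Audit

/-!
# Local Type I singularities and mild bounded ancient solutions (Albritton–Barker 2019)

Trunk T-FLUID (`Literature/Analysis/FluidPDE`), family NS, statement **ns.S23**; companion to
`Literature/Analysis/FluidPDE/PartialRegularity.lean` (`Literature.Analysis.FluidPDE.albritton_barker`).

D. Albritton and T. Barker, *On local Type I singularities of the Navier–Stokes equations and
Liouville theorems*, J. Math. Fluid Mech. 21 (2019), no. 3 (doi:10.1007/s00021-019-0448-z,
arXiv:1811.00502), prove: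

> **Theorem 1.1.** The following are equivalent:
> * There exists a suitable weak solution with Type I singular point.
> * There exists a non-trivial mild bounded ancient solution with `𝐈 < ∞`.

with the following terminology (§1, the displays following Thm 1.1; Def. 2.1). Physical space is
`ℝ³`, `z = (x, t)`, `Q(z, r) = B(x, r) × ]t - r², t[` is a (backward) *parabolic ball*; for
`Q' = Q(z, r)` and a pair `(v, q)`,
`A(Q') = esssup_{t-r²<t'<t} r⁻¹ ∫_{B(x,r)} |v(x', t')|² dx'`, `C(Q') = r⁻² ∫_{Q(z,r)} |v|³`,
`D(Q') = r⁻² ∫_{Q(z,r)} |q - [q]_{x,r}(t')|^{3/2}` (`[q]_{x,r}(t')` the mean of `q(·, t')` over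
`B(x, r)`), `E(Q') = r⁻¹ ∫_{Q(z,r)} |∇v|²`; for an open `ω ⊆ ℝ³⁺¹` on which `(v, q)` is defined,
`𝐈(ω) = sup_{Q' ⊂ ω} A(Q') + C(Q') + D(Q') + E(Q')`, the supremum over **all parabolic balls
`Q' ⊂ ω`**, and `𝐈 = 𝐈(ℝ³ × ℝ₋)` if `ω` is unspecified; "if `v` is not essentially bounded in any
parabolic ball centered at `z`, we say that `z` is a singular point"; "if there exists a parabolic
ball `Q'` centered at the singular point `z` and `𝐈(Q') < ∞`, then we say that `z` is a Type I
singularity". Suitable weak solutions in a parabolic ball are those of Def. 2.1 (unit viscosity,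
zero force; Lin 1998); mild bounded ancient solutions are those of
Koch–Nadirashvili–Seregin–Šverák 2009 (A–B §1).

## Why a second rendering of Theorem 1.1 (discrepancy with `NS.albritton_barker`)

The accepted `Literature.NS.albritton_barker := TypeISingularityExists ↔ NontrivialTypeIAncientExists`
(`PartialRegularity.lean`) deviates from the printed theorem in four points, the first of which
changes its mathematical content:

1. `Literature.Analysis.FluidPDE.IsTypeISingularPoint` bounds `⨆_{0<r<r₀} (A + C + D + E)(Q(z, r))` over the cylinders
   **centred at the singular point `z` only** (Seregin's quantities `g`, `G_r`, cf. Seregin 2022,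
   arXiv:1901.08842, §1), whereas A–B's Type I condition `𝐈(Q') < ∞` is a supremum over *all*
   parabolic balls `Q(z', r') ⊂ Q'`, centred anywhere in `Q'`. The printed proof of the forward
   direction (A–B §3) uses the bound at balls not centred at `z`: it first moves to an "earlier"
   singular point `z*` (Prop. 2.4) and then rescales around near-maximum points `z_k → z*`
   (Seregin–Šverák 2009, Thm 2.8) to produce a *mild bounded* ancient solution, whose bound
   `𝐈 < ∞` is inherited from the balls around the `z_k`. With centred bounds only, the rescaling
   at `z` itself yields a *local energy* ancient solution singular at the origin (the analogue of
   Seregin 2022, Thm 1.4, which works with the centred quantities), not a bounded one, and we are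
   not aware of a published argument deriving the all-balls bound from the centred one. So the
   forward implication of `NS.albritton_barker` is not the printed theorem.
2. `Fluid.cknD` integrates `|p|^{3/2}`; A–B's `D` subtracts the spatial mean `[q]_{x,r}(t')`
   (the pressure of a mild bounded ancient solution is determined up to a function of time only,
   which the mean-free `D` does not see).
3. `Fluid.cknA` takes `sup_t`; A–B's `A` takes `esssup_t`.
4. A–B's singular points are defined with *backward* balls `Q(z, r)` for a solution living on a
   parabolic ball `Q(z, r₀)` (so `z` lies on its parabolic boundary), whereas
   `Fluid.IsRegularPoint`/`Fluid.singularSet` use centred cylinders `Q*_r(z)` and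
   `IsTypeISingularPoint` asks for a suitable weak solution on an open neighbourhood of `z`
   (i.e. continued past the blow-up time).

Following the Literature discipline (never edit an accepted definition's meaning in place), this
file vendors the printed notions under new names and restates Theorem 1.1 over them as the named
fact `Literature.Analysis.FluidPDE.AlbrittonBarkerTypeICharacterization`, together with the two tools of its proof that
are stated in the paper itself: Lemma 2.2 (compactness of suitable weak solutions, after Lin 1998,
Thm 2.2) and Proposition 2.3 (persistence of singularities, after Rusin–Šverák 2011,
Lemmas 2.1–2.2), as the named facts `SuitableCompactness` and `PersistenceOfSingularities`.

## Contents

* `NS.cknAEss`, `NS.cknDOsc`, `NS.abScaledSum`, `NS.typeIBound ω` — A–B's `A`, `D`,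
  `A + C + D + E` (with the accepted `Fluid.cknC`, `Fluid.cknE` for `C`, `E`) and `𝐈(ω)`, all
  `ℝ≥0∞`-valued;
* `NS.IsBackwardSingularPoint u z` — "`u` is not essentially bounded in any parabolic ball
  centred at `z`"; `NS.IsLocalTypeISingularPoint`, `NS.LocalTypeISingularityExists` (first bullet
  of Thm 1.1), `NS.NontrivialMildAncientTypeIExists` (second bullet);
* the named facts `NS.AlbrittonBarkerTypeICharacterization` (Thm 1.1), `NS.SuitableCompactness`
  (Lemma 2.2), `NS.PersistenceOfSingularities` (Prop. 2.3); the two bullets of Thm 1.1,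
  `LocalTypeISingularityExists` and `NontrivialMildAncientTypeIExists`, are registered OPEN
  statements (`[status: open]`, see "Status of the two bullets" below), not named facts;
* `NS.IsSuitableWeakSolutionInBall` — Def. 2.1 (the accepted local notion on the open ball plus
  Def. 2.1's global integrability class on the ball);
* API: monotonicity of `𝐈` in `ω` (`typeIBound_mono`, `abScaledSum_le_typeIBound`),
  `typeIBound_empty`, `typeIBound_zero` (the trivial solution has `𝐈 = 0`), `cknAEss_le_cknA`
  (`esssup ≤ sup`), and the comparison with the accepted centred notion
  `IsBackwardSingularPoint.not_isRegularPoint` / `.mem_singularSet`.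

## Status of the two bullets of Theorem 1.1 (registered open statements)

Theorem 1.1 asserts an *equivalence*; the paper asserts neither bullet. Each bullet is an open
existence question about the unforced three-dimensional Navier–Stokes equations: a witness of
`LocalTypeISingularityExists` is a singular suitable weak solution (with a Type I singular
point), a witness of `NontrivialMildAncientTypeIExists` is a Type I blow-up profile — "many
questions concerning feasible Type I scenarios, e.g., discretely self-similar blow-up, remain
completely open"; "In principle, constructing ancient solutions with Type I decay is a
(difficult) route to obtaining Navier–Stokes singularities" (A–B §1, arXiv p. 3). Under the
Liouville conjecture (L) of Koch–Nadirashvili–Seregin–Šverák 2009 ("mild bounded ancient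
solutions are constant") both are false: "Together, `v ≡ const.` and `𝐈 < ∞` imply `v ≡ 0`",
"If true, the conjecture excludes Type I singularities" (A–B §1; in tree, for the printed `𝐈`
and up to a slice-measurability proviso, `LocalTypeILiouville.lean`:
`LiouvilleConjectureNS.not_nontrivialMildAncientTypeIExists_measurable`). Following
CONVENTIONS §4 ("open conjectures are `def … : Prop`, never asserted as a `theorem`") and the
treatment of their twins `TypeISingularityExists`, `NontrivialTypeIAncientExists` in
`PartialRegularity.lean`, both defs carry `OPEN CONJECTURE —` docstrings with `[status: open]`:
they are registered open statements, not literature debt — no `LocalTypeISingularityExists_holds`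
or `NontrivialMildAncientTypeIExists_holds` is to be expected. The names are kept (both are used
by `AlbrittonBarkerTypeICharacterization`, `LocalTypeICharacterization.lean`,
`LocalTypeIReverse.lean`, `LocalTypeILiouville.lean`).

## Design notes

* **Suitable weak solutions.** A–B's Def. 2.1 (on a parabolic ball `Q'`: `v ∈ L^∞_t L²_x ∩
  L²_t H¹_x(Q')`, `q ∈ L^{3/2}(Q')`, the equations in `𝒟'(Q')`, and the local energy inequality
  in its `a.e. t'` time-slice form for cut-offs `ζ ∈ C₀^∞(B(x,r) × ]t-r², t])`) is rendered as
  `IsSuitableWeakSolutionInBall r z u p`: the accepted local notion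
  `Fluid.IsSuitableWeakSolutionOn (Fluid.parabolicCylinderOpens r z) 1 0 u p` (CKN 1982 /
  Lin 1998, Def. 1: local integrability classes, distributional equations and the space–time
  integrated inequality for `φ ∈ C_c^∞` of the open ball) plus the three global integrability
  conditions of Def. 2.1 on the ball. Given the global class, the time-slice inequality for
  cut-offs not vanishing at the top time follows from the integrated one with `φ = ζ θ_ε(t)` at
  Lebesgue points `t'` and `t' ↑ t` (standard, cf. CKN 1982, §2); conversely the time-slice
  form integrates to the space–time form. No second structure for suitable weak solutions is
  introduced.
* **The pressure on the ancient side.** For a mild bounded ancient solution `u` the pressure is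
  KNSS's `p = R_i R_j (u_i u_j) ∈ L^∞_t BMO_x` (Seregin–Šverák 2009, Thm 2.4 and Remarks
  2.5–2.7), for which `(u, p)` is smooth and hence a suitable weak solution on every bounded
  cylinder; any other pressure `p'` with `(u, p')` a distributional solution on `ℝ³ × ℝ₋`
  differs from it by a function of `t`, invisible to the mean-free `D`. The second bullet is
  therefore rendered with `∃ p`, `(u, p)` a suitable weak solution on the slab `(-∞, 0) × ℝ³`,
  and `𝐈` computed from that `p` and the (a.e. unique) weak spatial gradient `G = ∇u`.
  "Non-trivial" is "not a.e. zero on `(-∞, 0) × ℝ³`" (mild bounded ancient solutions are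
  smooth, KNSS 2009); "mild bounded ancient solution" is the accepted
  `Fluid.IsBoundedAncientMildSolution 1 u` (KNSS 2009, §1, duality form; see the caveats on that
  class in `SelfSimilarLiouville.lean` — the parasitic `u = b(t)` it admits have `𝐈 = ∞` unless
  `b = 0` a.e., since `A(Q(z, r)) ~ r² |b|²`).
* **`𝐈(ω)`.** `typeIBound ω u p G = ⨆ (r > 0) (z) (_ : Q(z, r) ⊆ ω), (A + C + D + E)(Q(z, r))`
  in `ℝ≥0∞`; for `ω = ℝ³ × ℝ₋ = Iio 0 ×ˢ univ` the admissible balls are exactly those with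
  `t ≤ 0`. Radii `r ≤ 0` are excluded (`(ENNReal.ofReal r)⁻¹ = ∞` junk of the accepted
  `cknC/E`).
* **Junk values.** `cknDOsc` uses the Bochner average `⨍ y in B(x,r), p t' y` (`0` if `p(t', ·)`
  is not integrable on the ball; for `q ∈ L^{3/2}_loc` this happens only on a null set of
  times). `cknAEss r` for `r ≤ 0`: the ball is empty, the integrand is `∞ * 0 = 0`.
* **Lemma 2.2 / Prop. 2.3.** `Q = Q(0, 1)`; "`v^{(k)} → u` in `L³_loc(B × ]-1, 0])`,
  `q^{(k)} ⇀ p` in `L^{3/2}_loc(B × ]-1, 0])`" is rendered as strong `L³` / weak `L^{3/2}`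
  convergence on every `Q(0, R)`, `0 < R < 1` (these exhaust the compact subsets of
  `B × ]-1, 0]`), weak convergence being tested against `L³(Q(0, R))`. Prop. 2.3 is stated for
  sequences satisfying both the uniform bound of Lemma 2.2 and its convergences (its proof uses
  the uniform bound `M`), with the backward notion of singular point of §1.

## References

* D. Albritton, T. Barker, *On local Type I singularities of the Navier–Stokes equations and
  Liouville theorems*, J. Math. Fluid Mech. 21 (2019), no. 3, doi:10.1007/s00021-019-0448-z,
  arXiv:1811.00502: §1 (Thm 1.1 and the displays defining `A, C, D, E, 𝐈(ω)`, singular and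
  Type I points), Def. 2.1, Lemma 2.2, Prop. 2.3, Prop. 2.4, §3 (proof of Thm 1.1).
* F. Lin, *A new proof of the Caffarelli–Kohn–Nirenberg theorem*, Comm. Pure Appl. Math. 51
  (1998), 241–257: definition of suitable weak solutions in an open set `D` (p. 245), Thm 2.2.
* W. Rusin, V. Šverák, *Minimal initial data for potential Navier–Stokes singularities*,
  J. Funct. Anal. 260 (2011), 879–891, Lemmas 2.1–2.2.
* G. Seregin, V. Šverák, *On Type I singularities of the local axi-symmetric solutions of the
  Navier–Stokes equations*, Comm. PDE 34 (2009), 171–201, arXiv:0804.1803: §2, Def. 2.2–2.3,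
  Thm 2.4, Remarks 2.5–2.7, the standing conditions of §2 (arXiv labels `(b8)`–`(b10)`),
  Thm 2.8.
* G. Seregin, *On Type I blowups of suitable weak solutions to the Navier–Stokes equations near
  boundary*, J. Math. Sci. (N.Y.) (2022), doi:10.1007/s10958-021-05673-z, arXiv:1901.08842, §1
  (centred quantities `g`, `G_r`; Prop. 1.2, Thm 1.4, Thm 1.7).
* G. Koch, N. Nadirashvili, G. Seregin, V. Šverák, *Liouville theorems for the Navier–Stokes
  equations and applications*, Acta Math. 203 (2009), 83–105, §1.
-/

noncomputable section

open MeasureTheory Set Function Filter Topology TopologicalSpace Metric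
open scoped NNReal ENNReal InnerProductSpace RealInnerProductSpace

namespace Literature.Analysis.FluidPDE

/-- Local notation for physical space `ℝ³ = EuclideanSpace ℝ (Fin 3)`. -/
local notation "ℝ³" => EuclideanSpace ℝ (Fin 3)

/-! ## The scaled quantities of Albritton–Barker, as printed -/

section Quantities

/-- Albritton–Barker's scaled energy `A(Q') = esssup_{t-r² < t' < t} r⁻¹ ∫_{B(x,r)} |v(x', t')|² dx'`
for the parabolic ball `Q' = Q(z, r)`, `z = (t, x)` (time first), in `ℝ≥0∞`; the **essential**
supremum over `t' ∈ (t - r², t)` is taken with respect to Lebesgue measure (the accepted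
`Fluid.cknA` takes a genuine supremum instead, cf. `cknAEss_le_cknA`). Intended for `r > 0`.
[cite: AlbrittonBarker2019, §1 (display defining A after Thm 1.1)] -/
def cknAEss (r : ℝ) (z : ℝ × ℝ³) (u : ℝ → ℝ³ → ℝ³) : ℝ≥0∞ :=
  essSup (fun t : ℝ => (ENNReal.ofReal r)⁻¹ * ∫⁻ x in ball z.2 r, ‖u t x‖ₑ ^ 2)
    (volume.restrict (Ioo (z.1 - r ^ 2) z.1))

/-- Albritton–Barker's scaled pressure quantity
`D(Q') = r⁻² ∫_{Q(z,r)} |q - [q]_{x,r}(t')|^{3/2} dz'` for `Q' = Q(z, r)`, where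
`[q]_{x,r}(t') = ⨍_{B(x,r)} q(y, t') dy` is the spatial mean over the ball (the accepted
`Fluid.cknD` integrates `|q|^{3/2}` without subtracting the mean). In `ℝ≥0∞`; the mean is the
Bochner average (`0` if `q(t', ·)` is not integrable on `B(x, r)`). Intended for `r > 0`.
[cite: AlbrittonBarker2019, §1 (display defining D after Thm 1.1)] -/
def cknDOsc (r : ℝ) (z : ℝ × ℝ³) (p : ℝ → ℝ³ → ℝ) : ℝ≥0∞ :=
  (ENNReal.ofReal r ^ 2)⁻¹ *
    ∫⁻ w in FluidPDE.parabolicCylinder r z,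
      ‖p w.1 w.2 - ⨍ y in ball z.2 r, p w.1 y‖ₑ ^ (3 / 2 : ℝ)

/-- The sum `A(Q') + C(Q') + D(Q') + E(Q')` of Albritton–Barker's scaled quantities for the
parabolic ball `Q' = Q(z, r)`: `A` with the essential supremum (`cknAEss`), `C(Q') = r⁻² ∫_{Q'} |v|³`
and `E(Q') = r⁻¹ ∫_{Q'} |∇v|²` (the accepted `Fluid.cknC`, `Fluid.cknE`, with `G` standing for
`∇v`), and the mean-free pressure quantity `D` (`cknDOsc`).
[cite: AlbrittonBarker2019, §1 (displays defining A, C, D, E after Thm 1.1)] -/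
def abScaledSum (r : ℝ) (z : ℝ × ℝ³) (u : ℝ → ℝ³ → ℝ³) (p : ℝ → ℝ³ → ℝ)
    (G : ℝ → ℝ³ → ℝ³ →L[ℝ] ℝ³) : ℝ≥0∞ :=
  cknAEss r z u + FluidPDE.cknC r z u + cknDOsc r z p + FluidPDE.cknE r z G

/-- Albritton–Barker's **Type I quantity** `𝐈(ω) = sup_{Q' ⊂ ω} A(Q') + C(Q') + D(Q') + E(Q')`
of a pair `(v, q)` on a space–time region `ω ⊆ ℝ × ℝ³`: the supremum, in `ℝ≥0∞`, over **all**
parabolic balls `Q' = Q(z, r)`, `r > 0`, contained in `ω` (any centre, any radius). `G` stands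
for `∇v`. For `ω = ℝ³ × ℝ₋` (`Iio 0 ×ˢ univ`) this is A–B's `𝐈`.
[cite: AlbrittonBarker2019, §1 (display defining 𝐈(ω) after Thm 1.1)] -/
def typeIBound (ω : Set (ℝ × ℝ³)) (u : ℝ → ℝ³ → ℝ³) (p : ℝ → ℝ³ → ℝ)
    (G : ℝ → ℝ³ → ℝ³ →L[ℝ] ℝ³) : ℝ≥0∞ :=
  ⨆ (r : ℝ) (_ : 0 < r) (z : ℝ × ℝ³) (_ : FluidPDE.parabolicCylinder r z ⊆ ω), abScaledSum r z u p G

variable {r : ℝ} {z : ℝ × ℝ³} {u : ℝ → ℝ³ → ℝ³} {p : ℝ → ℝ³ → ℝ} {G : ℝ → ℝ³ → ℝ³ →L[ℝ] ℝ³}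
  {ω ω' : Set (ℝ × ℝ³)}

/-- `esssup ≤ sup`: Albritton–Barker's `A(Q(z, r))` is at most the accepted `Fluid.cknA r z u`
(almost every `t' ∈ (t - r², t)` is some `t' ∈ (t - r², t)`). [folklore] -/
theorem cknAEss_le_cknA : cknAEss r z u ≤ FluidPDE.cknA r z u := by
  refine essSup_le_of_ae_le _ ?_
  filter_upwards [ae_restrict_mem measurableSet_Ioo] with t ht
  exact le_iSup₂ (f := fun t (_ : t ∈ Ioo (z.1 - r ^ 2) z.1) =>
    (ENNReal.ofReal r)⁻¹ * ∫⁻ x in ball z.2 r, ‖u t x‖ₑ ^ 2) t ht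

/-- Each admissible ball contributes to `𝐈(ω)`: `(A + C + D + E)(Q(z, r)) ≤ 𝐈(ω)` whenever
`r > 0` and `Q(z, r) ⊆ ω`. [cite: AlbrittonBarker2019, §1] -/
theorem abScaledSum_le_typeIBound (hr : 0 < r) (h : FluidPDE.parabolicCylinder r z ⊆ ω) :
    abScaledSum r z u p G ≤ typeIBound ω u p G :=
  le_iSup_of_le r <| le_iSup_of_le hr <| le_iSup_of_le z <| le_iSup_of_le h le_rfl

/-- `𝐈(ω)` is monotone in the region (more balls are admissible). [cite: AlbrittonBarker2019, §1] -/
theorem typeIBound_mono (h : ω ⊆ ω') : typeIBound ω u p G ≤ typeIBound ω' u p G :=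
  iSup_mono fun _ => iSup_mono fun _ => iSup_mono fun _ => iSup_mono' fun hω => ⟨hω.trans h, le_rfl⟩

/-- `𝐈(ω) ≤ M` as soon as every admissible ball has `(A + C + D + E)(Q(z, r)) ≤ M`. [folklore] -/
theorem typeIBound_le_iff {M : ℝ≥0∞} :
    typeIBound ω u p G ≤ M ↔
      ∀ r : ℝ, 0 < r → ∀ z : ℝ × ℝ³, FluidPDE.parabolicCylinder r z ⊆ ω → abScaledSum r z u p G ≤ M := by
  simp only [typeIBound, iSup_le_iff]

/-- A parabolic ball of positive radius is nonempty (it contains `(t - r²/2, x)`). [folklore] -/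
theorem parabolicCylinder_nonempty (hr : 0 < r) (z : ℝ × ℝ³) :
    (FluidPDE.parabolicCylinder r z).Nonempty := by
  refine ⟨(z.1 - r ^ 2 / 2, z.2), ?_⟩
  rw [FluidPDE.mem_parabolicCylinder]
  refine ⟨⟨by nlinarith [sq_nonneg r], by nlinarith [sq_nonneg r, hr]⟩, by simpa using hr⟩

/-- `𝐈(∅) = 0`: no ball of positive radius fits in the empty region. [folklore] -/
theorem typeIBound_empty : typeIBound (∅ : Set (ℝ × ℝ³)) u p G = 0 := by
  refine le_antisymm ?_ (zero_le)
  refine typeIBound_le_iff.2 fun r hr z hz => ?_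
  exact absurd (subset_empty_iff.1 hz) (parabolicCylinder_nonempty hr z).ne_empty

/-- The zero field has `A = 0`. [folklore] -/
theorem cknAEss_zero (r : ℝ) (z : ℝ × ℝ³) : cknAEss r z (0 : ℝ → ℝ³ → ℝ³) = 0 := by
  simp only [cknAEss, Pi.zero_apply, enorm_zero, ne_eq, OfNat.ofNat_ne_zero, not_false_eq_true,
    zero_pow, lintegral_const, zero_mul, mul_zero]
  exact essSup_const_bot

/-- The zero pressure has `D = 0`. [folklore] -/
theorem cknDOsc_zero (r : ℝ) (z : ℝ × ℝ³) : cknDOsc r z (0 : ℝ → ℝ³ → ℝ) = 0 := by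
  simp [cknDOsc]

/-- The zero field has `C = 0` (accepted `Fluid.cknC`). [folklore] -/
theorem cknC_zero (r : ℝ) (z : ℝ × ℝ³) : FluidPDE.cknC r z (0 : ℝ → ℝ³ → ℝ³) = 0 := by
  simp [FluidPDE.cknC]

/-- The zero gradient has `E = 0` (accepted `Fluid.cknE`). [folklore] -/
theorem cknE_zero (r : ℝ) (z : ℝ × ℝ³) : FluidPDE.cknE r z (0 : ℝ → ℝ³ → ℝ³ →L[ℝ] ℝ³) = 0 := by
  simp [FluidPDE.cknE, FluidPDE.frobeniusNormSq_zero]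

/-- The trivial solution `(v, q) = (0, 0)` has `𝐈(ω) = 0` on every region (A–B §1: "`v ≡` const.
and `𝐈 < ∞` imply `v ≡ 0`" — the zero solution is the constant with finite `𝐈`). [folklore] -/
theorem typeIBound_zero : typeIBound ω (0 : ℝ → ℝ³ → ℝ³) 0 0 = 0 := by
  refine le_antisymm (typeIBound_le_iff.2 fun r _ z _ => ?_) (zero_le)
  simp [abScaledSum, cknAEss_zero, cknDOsc_zero, cknC_zero, cknE_zero]

end Quantities

/-! ## Singular points and Type I singular points (A–B §1) -/

section Singular

/-- **Singular points, backward form** (Albritton–Barker 2019, §1: "if `v` is not essentially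
bounded in any parabolic ball centered at `z`, we say that `z` is a singular point"): for every
`r > 0`, `u ∉ L^∞(Q(z, r))`, with the backward balls `Q(z, r) = (t - r², t) × B_r(x)`
(`Fluid.parabolicCylinder`). Only the values of `u` before time `t` enter; compare the accepted
`Fluid.IsRegularPoint` (centred cylinders `Q*_r(z)`), cf. `IsBackwardSingularPoint.not_isRegularPoint`.
[cite: AlbrittonBarker2019, §1 (definition of singular point after Thm 1.1)] -/
def IsBackwardSingularPoint (u : ℝ → ℝ³ → ℝ³) (z : ℝ × ℝ³) : Prop :=
  ∀ r : ℝ, 0 < r →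
    eLpNorm (uncurry u) ∞ (volume.restrict (FluidPDE.parabolicCylinder r z)) = ∞

variable {u : ℝ → ℝ³ → ℝ³} {z : ℝ × ℝ³}

/-- A backward singular point is not a regular point in the accepted (centred) sense: `u` is
unbounded on `Q(z, r) ⊆ Q*_r(z)` for every `r > 0`. [folklore] -/
theorem IsBackwardSingularPoint.not_isRegularPoint (h : IsBackwardSingularPoint u z) :
    ¬ FluidPDE.IsRegularPoint u z := by
  rintro ⟨r, hr, hfin⟩
  have hle : eLpNorm (uncurry u) ∞ (volume.restrict (FluidPDE.parabolicCylinder r z)) ≤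
      eLpNorm (uncurry u) ∞ (volume.restrict (FluidPDE.parabolicCylinderCentered r z)) :=
    eLpNorm_mono_measure _ (Measure.restrict_mono (FluidPDE.parabolicCylinder_subset_centered r z) le_rfl)
  rw [h r hr] at hle
  exact (lt_of_le_of_lt hle hfin).ne rfl

/-- Hence a backward singular point lying in a region `Q` belongs to the accepted singular set
`Fluid.singularSet u Q`. [folklore] -/
theorem IsBackwardSingularPoint.mem_singularSet (h : IsBackwardSingularPoint u z)
    {Q : Set (ℝ × ℝ³)} (hz : z ∈ Q) : z ∈ FluidPDE.singularSet u Q :=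
  ⟨hz, h.not_isRegularPoint⟩

/-- **Suitable weak solutions in a parabolic ball** (Albritton–Barker 2019, Def. 2.1, after
Lin 1998: "`v ∈ L^∞_t L²_x ∩ L²_t H¹_x(Q')` and `q ∈ L^{3/2}(Q')`, `(v, q)` satisfies the
Navier–Stokes equations on `Q'` in the sense of distributions, and the local energy
inequality"), for the unforced system with unit viscosity in `Q' = Q(z, r)`: the accepted local
notion `Fluid.IsSuitableWeakSolutionOn` on the open ball (distributional solution, local
energy inequality against `C_c^∞` cut-offs; CKN 1982, Lin 1998 Def. 1) together with Def. 2.1's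
*global* integrability class on the ball — `esssup_{t'} ∫_{B(x,r)} |v(t')|² < ∞`, `∇v ∈ L²(Q')`
(through a weak spatial gradient), `q ∈ L^{3/2}(Q')`. (Def. 2.1 states the energy inequality in
its a.e.-time-slice form for cut-offs `ζ ∈ C₀^∞(B(x,r) × ]t-r², t])`; given the global class it
follows from the integrated form with `φ = ζ θ_ε(t)` at Lebesgue points, CKN 1982, §2.)
[cite: AlbrittonBarker2019, Def. 2.1] -/
def IsSuitableWeakSolutionInBall (r : ℝ) (z : ℝ × ℝ³) (u : ℝ → ℝ³ → ℝ³) (p : ℝ → ℝ³ → ℝ) :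
    Prop :=
  FluidPDE.IsSuitableWeakSolutionOn (FluidPDE.parabolicCylinderOpens r z) 1 0 u p ∧
    (∃ C : ℝ≥0, ∀ᵐ t ∂(volume.restrict (Ioo (z.1 - r ^ 2) z.1)),
      ∫⁻ x in ball z.2 r, ‖u t x‖ₑ ^ 2 ≤ C) ∧
    (∃ G : ℝ → ℝ³ → ℝ³ →L[ℝ] ℝ³,
      FluidPDE.HasWeakSpatialGradientOn (FluidPDE.parabolicCylinderOpens r z) u G ∧
      ∫⁻ w in FluidPDE.parabolicCylinder r z, ENNReal.ofReal (FluidPDE.frobeniusNormSq (G w.1 w.2)) < ∞) ∧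
    MemLp (uncurry p) (3 / 2) (volume.restrict (FluidPDE.parabolicCylinder r z))

/-- **Type I singular points** (Albritton–Barker 2019, §1 with Def. 2.1): `(u, p)` is a suitable
weak solution of the unforced Navier–Stokes system (`ν = 1`) in the parabolic ball `Q(z, r₀)`,
`r₀ > 0` (`IsSuitableWeakSolutionInBall`), the centre `z` (on its parabolic boundary) is a
singular point in the backward sense, and A–B's Type I quantity of the ball is finite:
`𝐈(Q(z, r₀)) = sup_{Q(z',r') ⊆ Q(z,r₀)} (A + C + D + E)(Q(z', r')) < ∞`, `∇u` being represented
by a weak spatial gradient `G` of `u` on the ball. (A–B allow the solution to live on a larger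
region `ω ⊇ Q(z, r₀)` with `𝐈(Q') < ∞` for some ball `Q'` centred at `z`; restricting to that
ball loses nothing.)
[cite: AlbrittonBarker2019, §1 (definition of Type I singularity) and Def. 2.1] -/
def IsLocalTypeISingularPoint (r₀ : ℝ) (z : ℝ × ℝ³) (u : ℝ → ℝ³ → ℝ³) (p : ℝ → ℝ³ → ℝ) :
    Prop :=
  0 < r₀ ∧ IsSuitableWeakSolutionInBall r₀ z u p ∧ IsBackwardSingularPoint u z ∧
    ∃ G : ℝ → ℝ³ → ℝ³ →L[ℝ] ℝ³,
      FluidPDE.HasWeakSpatialGradientOn (FluidPDE.parabolicCylinderOpens r₀ z) u G ∧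
      typeIBound (FluidPDE.parabolicCylinder r₀ z) u p G < ∞

/-- OPEN CONJECTURE — registered open statement (an open existence *question*; nobody asserts it
in print): the **first bullet of Albritton–Barker 2019, Thm 1.1**, "there exists a suitable weak
solution with Type I singular point" — some `(u, p)` is a suitable weak solution in a parabolic
ball `Q(z, r₀)` whose centre is a Type I singular point in the printed sense
(`IsLocalTypeISingularPoint`: backward singular point, `𝐈(Q(z, r₀)) < ∞` over all parabolic
sub-balls). The paper asserts only the *equivalence* of this bullet with the second one
(`NontrivialMildAncientTypeIExists`; the equivalence is the named fact
`AlbrittonBarkerTypeICharacterization`), never the bullet itself: whether (Type I) singular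
points of suitable weak solutions of the unforced equations occur at all is open ("many
questions concerning feasible Type I scenarios, e.g., discretely self-similar blow-up, remain
completely open", A–B §1), and under the Liouville conjecture (L) of
Koch–Nadirashvili–Seregin–Šverák 2009 they do not ("If true, the conjecture excludes Type I
singularities", A–B §1). Registered here as an open statement (CONVENTIONS §4), not literature
debt: no `LocalTypeISingularityExists_holds` is to be expected; the name is kept (left-hand side
of `AlbrittonBarkerTypeICharacterization`, used by `LocalTypeICharacterization.lean` and
`LocalTypeIReverse.lean`).
[cite: AlbrittonBarker2019, Thm 1.1 (first bullet); §1 (Type I scenarios open)] [status: open] -/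
@[conjecture] def LocalTypeISingularityExists : Prop :=
  ∃ (r₀ : ℝ) (z : ℝ × ℝ³) (u : ℝ → ℝ³ → ℝ³) (p : ℝ → ℝ³ → ℝ), IsLocalTypeISingularPoint r₀ z u p

/-- OPEN CONJECTURE — registered open statement, expected to be **false** under the Liouville
conjecture (L) of Koch–Nadirashvili–Seregin–Šverák 2009: the **second bullet of Albritton–Barker
2019, Thm 1.1**, "there exists a non-trivial mild bounded ancient solution with `𝐈 < ∞`" — a mild
bounded ancient solution `u` of Navier–Stokes (`ν = 1`) on `ℝ³ × ℝ₋` (KNSS 2009; the accepted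
`Fluid.IsBoundedAncientMildSolution`) which is not a.e. zero there, together with a pressure `p`
making `(u, p)` a suitable weak solution on the slab `(-∞, 0) × ℝ³` and a weak spatial gradient
`G = ∇u` there, such that `𝐈 = 𝐈(ℝ³ × ℝ₋) = sup_{Q(z,r) ⊆ ℝ³ × ℝ₋} (A + C + D + E)(Q(z, r)) < ∞`.
(The KNSS pressure `R_i R_j(u_i u_j)` is such a `p`; any two differ by a function of `t`,
invisible to `D`.) The paper asserts only the *equivalence* of this bullet with the existence of
a Type I singular point (`AlbrittonBarkerTypeICharacterization`), never the bullet itself: a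
witness would be a Type I blow-up profile of the three-dimensional Navier–Stokes equations ("In
principle, constructing ancient solutions with Type I decay is a (difficult) route to obtaining
Navier–Stokes singularities", A–B §1), and (L) would refute it ("Together, `v ≡ const.` and
`𝐈 < ∞` imply `v ≡ 0`"; "If true, the conjecture excludes Type I singularities", A–B §1; in
tree, up to a slice-measurability proviso:
`LiouvilleConjectureNS.not_nontrivialMildAncientTypeIExists_measurable`,
`LocalTypeILiouville.lean`). Registered here as an open statement (CONVENTIONS §4), not
literature debt: no `NontrivialMildAncientTypeIExists_holds` is to be expected; users keep the
explicit hypothesis `(h : NontrivialMildAncientTypeIExists)`. The name is kept (right-hand side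
of `AlbrittonBarkerTypeICharacterization`, used by `LocalTypeICharacterization.lean`,
`LocalTypeIReverse.lean`, `LocalTypeILiouville.lean`) rather than renamed `…Conjecture`; its twin
over the accepted centred quantities is `NontrivialTypeIAncientExists` (`PartialRegularity.lean`).
[cite: AlbrittonBarker2019, Thm 1.1 (second bullet) and §1 (open; refuted by (L))] [status: open] -/
def NontrivialMildAncientTypeIExists : Prop :=
  ∃ (u : ℝ → ℝ³ → ℝ³) (p : ℝ → ℝ³ → ℝ) (G : ℝ → ℝ³ → ℝ³ →L[ℝ] ℝ³),
    FluidPDE.IsBoundedAncientMildSolution 1 u ∧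
    FluidPDE.IsSuitableWeakSolutionOn (FluidPDE.slab ℝ³ (Iio 0) isOpen_Iio) 1 0 u p ∧
    FluidPDE.HasWeakSpatialGradientOn (FluidPDE.slab ℝ³ (Iio 0) isOpen_Iio) u G ∧
    ¬ (uncurry u =ᵐ[volume.restrict (Iio (0 : ℝ) ×ˢ (univ : Set ℝ³))] 0) ∧
    typeIBound (Iio (0 : ℝ) ×ˢ (univ : Set ℝ³)) u p G < ∞

/-- **Albritton–Barker 2019, Theorem 1.1** ("The following are equivalent: • There exists a
suitable weak solution with Type I singular point. • There exists a non-trivial mild bounded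
ancient solution with `𝐈 < ∞`."), over the printed notions: Type I means
`𝐈(Q') = sup_{Q'' ⊂ Q'} (A + C + D + E)(Q'') < ∞` for a parabolic ball `Q'` centred at the
singular point, the supremum over *all* parabolic sub-balls, with mean-free pressure in `D` and
`esssup_t` in `A`. This is the corrected rendering of ns.S23; the accepted
`NS.albritton_barker` uses cylinders centred at the singular point only (see the module
docstring for the discrepancy). The forward direction is the Seregin–Šverák rescaling at an
earliest singular point (A–B Prop. 2.4; Seregin–Šverák 2009, Thm 2.8), the converse zooms out on
the ancient solution (`v^{(k)}(x,t) = k v(kx, k²t)`), using `SuitableCompactness` and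
`PersistenceOfSingularities`. [cite: AlbrittonBarker2019, Thm 1.1] -/
def AlbrittonBarkerTypeICharacterization : Prop :=
  LocalTypeISingularityExists ↔ NontrivialMildAncientTypeIExists

end Singular

/-! ## Tools of the proof stated in the paper (A–B Lemma 2.2, Prop. 2.3) -/

section Tools

/-- **Compactness of suitable weak solutions** (Albritton–Barker 2019, Lemma 2.2, "proven in
[Lin 1998]"; Lin 1998, Thm 2.2). Let `(v^{(k)}, q^{(k)})` be suitable weak solutions on the unit
parabolic ball `Q = Q(0, 1)` with `sup_k ‖v^{(k)}‖_{L³(Q)} + ‖q^{(k)}‖_{L^{3/2}(Q)} < ∞`. Then,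
along a subsequence, `v^{(k)} → u` in `L³_loc(B × ]-1, 0])` and `q^{(k)} ⇀ p` in
`L^{3/2}_loc(B × ]-1, 0])` for a pair `(u, p)` which is a suitable weak solution on `Q(0, R)` for
every `0 < R < 1`; here rendered on the exhausting balls `Q(0, R)`, `0 < R < 1`: strong `L³`
convergence, and weak `L^{3/2}` convergence tested against `L³(Q(0, R))`.
[cite: AlbrittonBarker2019, Lemma 2.2] -/
def SuitableCompactness : Prop :=
  ∀ (v : ℕ → ℝ → ℝ³ → ℝ³) (q : ℕ → ℝ → ℝ³ → ℝ),
    (∀ k, IsSuitableWeakSolutionInBall 1 0 (v k) (q k)) →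
    (⨆ k, eLpNorm (uncurry (v k)) 3
        (volume.restrict (FluidPDE.parabolicCylinder 1 (0 : ℝ × ℝ³))) +
      eLpNorm (uncurry (q k)) (3 / 2)
        (volume.restrict (FluidPDE.parabolicCylinder 1 (0 : ℝ × ℝ³)))) < ∞ →
    ∃ (u : ℝ → ℝ³ → ℝ³) (p : ℝ → ℝ³ → ℝ) (σ : ℕ → ℕ), StrictMono σ ∧
      ∀ R ∈ Ioo (0 : ℝ) 1,
        IsSuitableWeakSolutionInBall R 0 u p ∧
        MemLp (uncurry u) 3 (volume.restrict (FluidPDE.parabolicCylinder R (0 : ℝ × ℝ³))) ∧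
        Tendsto (fun j => eLpNorm (uncurry (v (σ j)) - uncurry u) 3
          (volume.restrict (FluidPDE.parabolicCylinder R (0 : ℝ × ℝ³)))) atTop (𝓝 0) ∧
        ∀ g : ℝ × ℝ³ → ℝ, MemLp g 3 (volume.restrict (FluidPDE.parabolicCylinder R (0 : ℝ × ℝ³))) →
          Tendsto (fun j => ∫ w in FluidPDE.parabolicCylinder R (0 : ℝ × ℝ³), q (σ j) w.1 w.2 * g w)
            atTop (𝓝 (∫ w in FluidPDE.parabolicCylinder R (0 : ℝ × ℝ³), p w.1 w.2 * g w))

/-- **Persistence of singularities** (Albritton–Barker 2019, Prop. 2.3; "contained in Lemma 2.1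
and Lemma 2.2 of [Rusin–Šverák 2011]"). Let `(v^{(k)}, q^{(k)})` be suitable weak solutions on
`Q = Q(0, 1)` with the uniform bound of Lemma 2.2 and converging as there (along the whole
sequence) to a suitable weak solution `(u, p)` on the balls `Q(0, R)`, `0 < R < 1`. If
`limsup_{k → ∞} ‖v^{(k)}‖_{L^∞(Q(0, R))} = ∞` for all `0 < R < 1`, then `u` has a singularity at
the space–time origin (backward sense, `IsBackwardSingularPoint u 0`). The proof rests on the
ε-regularity criterion of Caffarelli–Kohn–Nirenberg. [cite: AlbrittonBarker2019, Prop. 2.3] -/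
def PersistenceOfSingularities : Prop :=
  ∀ (v : ℕ → ℝ → ℝ³ → ℝ³) (q : ℕ → ℝ → ℝ³ → ℝ) (u : ℝ → ℝ³ → ℝ³) (p : ℝ → ℝ³ → ℝ),
    (∀ k, IsSuitableWeakSolutionInBall 1 0 (v k) (q k)) →
    (⨆ k, eLpNorm (uncurry (v k)) 3
        (volume.restrict (FluidPDE.parabolicCylinder 1 (0 : ℝ × ℝ³))) +
      eLpNorm (uncurry (q k)) (3 / 2)
        (volume.restrict (FluidPDE.parabolicCylinder 1 (0 : ℝ × ℝ³)))) < ∞ →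
    (∀ R ∈ Ioo (0 : ℝ) 1,
        IsSuitableWeakSolutionInBall R 0 u p ∧
        Tendsto (fun k => eLpNorm (uncurry (v k) - uncurry u) 3
          (volume.restrict (FluidPDE.parabolicCylinder R (0 : ℝ × ℝ³)))) atTop (𝓝 0) ∧
        ∀ g : ℝ × ℝ³ → ℝ, MemLp g 3 (volume.restrict (FluidPDE.parabolicCylinder R (0 : ℝ × ℝ³))) →
          Tendsto (fun k => ∫ w in FluidPDE.parabolicCylinder R (0 : ℝ × ℝ³), q k w.1 w.2 * g w)
            atTop (𝓝 (∫ w in FluidPDE.parabolicCylinder R (0 : ℝ × ℝ³), p w.1 w.2 * g w))) →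
    (∀ R ∈ Ioo (0 : ℝ) 1, limsup (fun k => eLpNorm (uncurry (v k)) ∞
        (volume.restrict (FluidPDE.parabolicCylinder R (0 : ℝ × ℝ³)))) atTop = ∞) →
    IsBackwardSingularPoint u 0

end Tools

end Literature.Analysis.FluidPDE
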